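import Literature.Analysis.PDE.CutoffCalculus
import Mathlib.Analysis.InnerProductSpace.Adjoint
import Mathlib.Analysis.Calculus.FDeriv.Equiv
import HarnessLib

/-!
# Second-order operators in frame form, and their behaviour under affine changes of variables
# (topic `Analysis/PDE`)

Analytic layer of the programme to prove short-time existence for quasilinear strictly
parabolic systems on a closed manifold (hypothesis `hQL` of
`Literature.Geometry.Riemannian.ricciFlow_shortTime_existence_of_quasilinear`). The chart
expression of a parabolic system with SCALAR principal symbol is, in the Euclidean model `E`
with its standard orthonormal frame `(bₖ)`,

  `L v = Σₖₗ ⟪bₖ, S bₗ⟫ • ∂ₖ∂ₗv + 𝔟(Dv) + 𝔠(v)`,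

with a symbol operator `S : E →L E` (symmetric, positive definite), a first-order coefficient
`𝔟 : (E →L F) →L F` and a zeroth-order coefficient `𝔠 : F →L F`. This file introduces the
principal part `principalPart S v` and proves:

* `principalPart_eq_sum_fderiv_fderiv` — the frame-free form `Σₗ D²v(S bₗ, bₗ)`;
* `principalPart_one` — `principalPart 1 v = Δv`;
* linearity in the symbol (`principalPart_add`, `principalPart_sub`, `principalPart_smul`);
* `norm_principalPart_sub_le` — the pointwise bound behind the freezing of coefficients,
  `‖principalPart S v - principalPart S' v‖ ≤ Σₖₗ ‖S - S'‖ ‖∂ₖ∂ₗv‖`;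
* **affine changes of variables** `φ y = A y + c` (`A` a continuous linear automorphism):
  `D(v' ∘ φ)(y) = Dv'(φ y) ∘ A` (`fderiv_comp_affine`), the second frame derivatives
  (`fderiv_fderiv_comp_affine`), the trace identity `Σₗ B(T bₗ, R bₗ) = Σₗ B(T R† bₗ, bₗ)`
  (`sum_bilinear_basis_eq`), and
  `principalPart S (v' ∘ φ) y = principalPart (A S A†) v' (φ y)` (`principalPart_comp_affine`) —
  so that in a frame with `A S A† = 1` the frozen principal part is the flat Laplacian
  (`principalPart_comp_affine_eq_laplacian`).

Everything is proved; no named fact and no `sorry` is introduced.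

## References

* L. Hörmander, *The Analysis of Linear Partial Differential Operators III*, Springer 1985,
  §17.1 (reduction of a second-order elliptic operator with frozen coefficients to the Laplacian
  by a linear change of variables). [Hormander1985III]
-/

noncomputable section

open Set Function Filter Topology InnerProductSpace
open scoped RealInnerProductSpace Laplacian ContDiff

namespace Literature.Analysis.PDE

variable {E : Type*} [NormedAddCommGroup E] [InnerProductSpace ℝ E] [FiniteDimensional ℝ E]
variable {F : Type*} [NormedAddCommGroup F] [NormedSpace ℝ F]

/-! ### The principal part in frame form -/

section Principal

/-- **The principal part in frame form**: `principalPart S v y = Σₖₗ ⟪bₖ, S bₗ⟫ • ∂ₖ∂ₗv(y)` in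
the standard orthonormal frame `b`, for a symbol operator `S : E →L E`.
[cite: Hormander1985III, §17.1] -/
def principalPart (S : E →L[ℝ] E) (v : E → F) (y : E) : F :=
  ∑ k, ∑ l, ⟪stdOrthonormalBasis ℝ E k, S (stdOrthonormalBasis ℝ E l)⟫ •
    fderiv ℝ (fun z ↦ fderiv ℝ v z (stdOrthonormalBasis ℝ E l)) y (stdOrthonormalBasis ℝ E k)

/-- `principalPart_apply`: unfolding. [folklore] -/
theorem principalPart_apply (S : E →L[ℝ] E) (v : E → F) (y : E) :
    principalPart S v y = ∑ k, ∑ l, ⟪stdOrthonormalBasis ℝ E k, S (stdOrthonormalBasis ℝ E l)⟫ •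
      fderiv ℝ (fun z ↦ fderiv ℝ v z (stdOrthonormalBasis ℝ E l)) y (stdOrthonormalBasis ℝ E k) := rfl

/-- **Frame-free form**: `principalPart S v y = Σₗ D²v(y)(S bₗ)(bₗ)`, i.e. the `∂_{S bₗ}`
derivative of `∂ₗ v` summed over the frame. [folklore] -/
theorem principalPart_eq_sum_fderiv_fderiv (S : E →L[ℝ] E) (v : E → F) (y : E) :
    principalPart S v y =
      ∑ l, fderiv ℝ (fun z ↦ fderiv ℝ v z (stdOrthonormalBasis ℝ E l)) y (S (stdOrthonormalBasis ℝ E l)) := by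
  set b := stdOrthonormalBasis ℝ E
  rw [principalPart_apply, Finset.sum_comm]
  refine Finset.sum_congr rfl fun l _ ↦ ?_
  have hS : S (b l) = ∑ k, ⟪b k, S (b l)⟫ • b k := (b.sum_repr' (S (b l))).symm
  conv_rhs => rw [hS, map_sum]
  refine Finset.sum_congr rfl fun k _ ↦ ?_
  rw [map_smul]

/-- **The principal part with symbol `1` is the Laplacian** (for `C²` functions). [folklore] -/
theorem principalPart_one {v : E → F} (hv : ContDiff ℝ 2 v) (y : E) :
    principalPart (1 : E →L[ℝ] E) v y = (Δ v) y := by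
  rw [principalPart_eq_sum_fderiv_fderiv,
    Literature.Analysis.FluidPDE.laplacian_eq_sum_fderiv_fderiv_normed (stdOrthonormalBasis ℝ E) hv y]
  rfl

/-- Additivity in the symbol. [folklore] -/
theorem principalPart_add (S S' : E →L[ℝ] E) (v : E → F) (y : E) :
    principalPart (S + S') v y = principalPart S v y + principalPart S' v y := by
  simp only [principalPart_eq_sum_fderiv_fderiv, add_apply, map_add,
    Finset.sum_add_distrib]

/-- Subtraction in the symbol. [folklore] -/
theorem principalPart_sub (S S' : E →L[ℝ] E) (v : E → F) (y : E) :
    principalPart (S - S') v y = principalPart S v y - principalPart S' v y := by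
  simp only [principalPart_eq_sum_fderiv_fderiv, sub_apply, map_sub,
    Finset.sum_sub_distrib]

/-- Homogeneity in the symbol. [folklore] -/
theorem principalPart_smul (c : ℝ) (S : E →L[ℝ] E) (v : E → F) (y : E) :
    principalPart (c • S) v y = c • principalPart S v y := by
  simp only [principalPart_eq_sum_fderiv_fderiv, smul_apply, map_smul,
    Finset.smul_sum]

/-- **Pointwise bound for the difference of two principal parts** (freezing of coefficients):
`‖principalPart S v y - principalPart S' v y‖ ≤ Σₖₗ ‖S - S'‖ ‖∂ₖ∂ₗv(y)‖`. [folklore] -/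
theorem norm_principalPart_sub_le (S S' : E →L[ℝ] E) (v : E → F) (y : E) :
    ‖principalPart S v y - principalPart S' v y‖ ≤
      ∑ k, ∑ l, ‖S - S'‖ *
        ‖fderiv ℝ (fun z ↦ fderiv ℝ v z (stdOrthonormalBasis ℝ E l)) y (stdOrthonormalBasis ℝ E k)‖ := by
  set b := stdOrthonormalBasis ℝ E
  rw [← principalPart_sub, principalPart_apply]
  refine (norm_sum_le _ _).trans (Finset.sum_le_sum fun k _ ↦ ?_)
  refine (norm_sum_le _ _).trans (Finset.sum_le_sum fun l _ ↦ ?_)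
  rw [norm_smul]
  refine mul_le_mul_of_nonneg_right ?_ (norm_nonneg _)
  rw [Real.norm_eq_abs]
  calc |⟪b k, (S - S') (b l)⟫| ≤ ‖b k‖ * ‖(S - S') (b l)‖ := abs_real_inner_le_norm _ _
    _ ≤ ‖b k‖ * (‖S - S'‖ * ‖b l‖) :=
        mul_le_mul_of_nonneg_left (ContinuousLinearMap.le_opNorm _ _) (norm_nonneg _)
    _ = ‖S - S'‖ := by rw [b.orthonormal.1 k, b.orthonormal.1 l]; ring

end Principal

/-! ### Affine changes of variables -/

section Affine

variable (A : E ≃L[ℝ] E) (c : E)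

omit [FiniteDimensional ℝ E] in
/-- **First derivatives under an affine change of variables** `φ y = A y + c`:
`D(v' ∘ φ)(y) = Dv'(φ y) ∘ A` (no differentiability hypothesis). [folklore] -/
theorem fderiv_comp_affine (v' : E → F) (y : E) :
    fderiv ℝ (fun y ↦ v' (A y + c)) y = (fderiv ℝ v' (A y + c)).comp (A : E →L[ℝ] E) := by
  have h1 : (fun y ↦ v' (A y + c)) = (fun z ↦ v' (z + c)) ∘ (A : E → E) := rfl
  rw [h1, A.comp_right_fderiv]
  simp only [fderiv_comp_add_right]

omit [FiniteDimensional ℝ E] in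
/-- Directional form of `fderiv_comp_affine`. [folklore] -/
theorem fderiv_comp_affine_apply (v' : E → F) (y u : E) :
    fderiv ℝ (fun y ↦ v' (A y + c)) y u = fderiv ℝ v' (A y + c) (A u) := by
  rw [fderiv_comp_affine]
  rfl

omit [FiniteDimensional ℝ E] in
/-- **Second frame derivatives under an affine change of variables**:
`∂ᵤ∂ᵤ'(v' ∘ φ)(y) = D²v'(φ y)(A u)(A u')`. [folklore] -/
theorem fderiv_fderiv_comp_affine_apply (v' : E → F) (y u u' : E) :
    fderiv ℝ (fun z ↦ fderiv ℝ (fun y ↦ v' (A y + c)) z u') y u =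
      fderiv ℝ (fun z ↦ fderiv ℝ v' z (A u')) (A y + c) (A u) := by
  have h : (fun z ↦ fderiv ℝ (fun y ↦ v' (A y + c)) z u') =
      fun z ↦ (fun w ↦ fderiv ℝ v' w (A u')) (A z + c) := by
    funext z
    exact fderiv_comp_affine_apply A c v' z u'
  rw [h]
  exact fderiv_comp_affine_apply A c (fun w ↦ fderiv ℝ v' w (A u')) y u

variable {A c}

omit [FiniteDimensional ℝ E] in
/-- For a `C²` function the second directional derivative is linear in the inner direction.
[folklore] -/
theorem fderiv_fderiv_apply_linear {v : E → F} (hv : ContDiff ℝ 2 v) (x w : E) :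
    IsLinearMap ℝ fun u : E ↦ fderiv ℝ (fun z ↦ fderiv ℝ v z u) x w := by
  have hd : DifferentiableAt ℝ (fderiv ℝ v) x :=
    ((hv.fderiv_right (m := 1) le_rfl).differentiable one_ne_zero) x
  have key : ∀ u, fderiv ℝ (fun z ↦ fderiv ℝ v z u) x w = fderiv ℝ (fderiv ℝ v) x w u := by
    intro u
    rw [fderiv_clm_apply hd (differentiableAt_const u)]
    simp
  constructor
  · intro u u'
    rw [key (u + u'), key u, key u', map_add]
  · intro r u
    rw [key (r • u), key u, map_smul]

/-- **Trace identity**: for a map `B` linear in its first argument, an orthonormal basis `b` and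
operators `T`, `R`: `Σₗ B(T bₗ)(R bₗ) = Σₗ B(T R† bₗ)(bₗ)` when `B` is also linear in the
second slot. [folklore] -/
theorem sum_bilinear_basis_eq {G : Type*} [AddCommGroup G] [Module ℝ G]
    (B : E →ₗ[ℝ] E →ₗ[ℝ] G) (T R : E →L[ℝ] E) :
    ∑ l, B (T (stdOrthonormalBasis ℝ E l)) (R (stdOrthonormalBasis ℝ E l)) =
      ∑ l, B (T (ContinuousLinearMap.adjoint R (stdOrthonormalBasis ℝ E l)))
        (stdOrthonormalBasis ℝ E l) := by
  haveI : CompleteSpace E := FiniteDimensional.complete ℝ E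
  set b := stdOrthonormalBasis ℝ E
  -- expand `R bₗ` in the basis
  have hR : ∀ l, R (b l) = ∑ m, ⟪b m, R (b l)⟫ • b m := fun l ↦ (b.sum_repr' (R (b l))).symm
  have hRadj : ∀ m, ContinuousLinearMap.adjoint R (b m) = ∑ l, ⟪b m, R (b l)⟫ • b l := by
    intro m
    rw [← b.sum_repr' (ContinuousLinearMap.adjoint R (b m))]
    refine Finset.sum_congr rfl fun l _ ↦ ?_
    rw [ContinuousLinearMap.adjoint_inner_right, real_inner_comm]
  calc ∑ l, B (T (b l)) (R (b l)) = ∑ l, ∑ m, ⟪b m, R (b l)⟫ • B (T (b l)) (b m) := by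
        refine Finset.sum_congr rfl fun l _ ↦ ?_
        conv_lhs => rw [hR l]
        rw [map_sum]
        refine Finset.sum_congr rfl fun m _ ↦ ?_
        rw [map_smul]
    _ = ∑ m, ∑ l, ⟪b m, R (b l)⟫ • B (T (b l)) (b m) := Finset.sum_comm
    _ = ∑ m, B (T (ContinuousLinearMap.adjoint R (b m))) (b m) := by
        refine Finset.sum_congr rfl fun m _ ↦ ?_
        rw [hRadj m, map_sum, map_sum, LinearMap.sum_apply]
        refine Finset.sum_congr rfl fun l _ ↦ ?_
        rw [map_smul, map_smul, LinearMap.smul_apply]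

/-- **The principal part under an affine change of variables**: for `v'` of class `C²` and
`φ y = A y + c`, `principalPart S (v' ∘ φ) y = principalPart (A S A†) v' (φ y)`.
[cite: Hormander1985III, §17.1] -/
theorem principalPart_comp_affine (S : E →L[ℝ] E) {v' : E → F} (hv' : ContDiff ℝ 2 v') (y : E) :
    principalPart S (fun y ↦ v' (A y + c)) y =
      principalPart ((A : E →L[ℝ] E) ∘L S ∘L ContinuousLinearMap.adjoint (A : E →L[ℝ] E)) v'
        (A y + c) := by
  set b := stdOrthonormalBasis ℝ E
  set x := A y + c with hx
  rw [principalPart_eq_sum_fderiv_fderiv, principalPart_eq_sum_fderiv_fderiv]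
  simp_rw [fderiv_fderiv_comp_affine_apply A c v' y]
  -- the second derivative of `v'` at `x` as a map bilinear in the two directions
  have hlin_in : ∀ w, IsLinearMap ℝ fun u : E ↦ fderiv ℝ (fun z ↦ fderiv ℝ v' z u) x w :=
    fun w ↦ fderiv_fderiv_apply_linear hv' x w
  set B : E →ₗ[ℝ] E →ₗ[ℝ] F :=
    { toFun := fun w ↦ (hlin_in w).mk' _
      map_add' := fun w w' ↦ by
        ext u
        simp [IsLinearMap.mk'_apply, map_add]
      map_smul' := fun r w ↦ by
        ext u
        simp [IsLinearMap.mk'_apply, map_smul] } with hB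
  have hBap : ∀ w u, B w u = fderiv ℝ (fun z ↦ fderiv ℝ v' z u) x w := fun w u ↦ rfl
  have key := sum_bilinear_basis_eq B ((A : E →L[ℝ] E) ∘L S) (A : E →L[ℝ] E)
  simp only [hBap, ContinuousLinearMap.comp_apply] at key
  -- `B (A S bₗ) (A bₗ)` summed equals `B (A S A† bₗ) (bₗ)` summed
  exact key.trans (Finset.sum_congr rfl fun l _ ↦ rfl)

/-- In a frame normalising the symbol the frozen principal part is the flat Laplacian:
if `A S A† = 1` then `principalPart S (v' ∘ φ) y = (Δ v')(φ y)`. [cite: Hormander1985III, §17.1] -/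
theorem principalPart_comp_affine_eq_laplacian (S : E →L[ℝ] E)
    (hA : (A : E →L[ℝ] E) ∘L S ∘L ContinuousLinearMap.adjoint (A : E →L[ℝ] E) = 1)
    {v' : E → F} (hv' : ContDiff ℝ 2 v') (y : E) :
    principalPart S (fun y ↦ v' (A y + c)) y = (Δ v') (A y + c) := by
  rw [principalPart_comp_affine S hv' y, hA, principalPart_one hv']

end Affine

/-! ### The full operator -/

section Operator

/-- **A second-order operator in frame form**: symbol `S`, first-order coefficient `𝔟`
(acting on the full derivative) and zeroth-order coefficient `𝔠`.
[cite: Hormander1985III, §17.1] -/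
def frameOp (S : E →L[ℝ] E) (𝔟 : (E →L[ℝ] F) →L[ℝ] F) (𝔠 : F →L[ℝ] F) (v : E → F) (y : E) : F :=
  principalPart S v y + 𝔟 (fderiv ℝ v y) + 𝔠 (v y)

/-- `frameOp_apply`: unfolding. [folklore] -/
theorem frameOp_apply (S : E →L[ℝ] E) (𝔟 : (E →L[ℝ] F) →L[ℝ] F) (𝔠 : F →L[ℝ] F) (v : E → F) (y : E) :
    frameOp S 𝔟 𝔠 v y = principalPart S v y + 𝔟 (fderiv ℝ v y) + 𝔠 (v y) := rfl

/-- Precomposition with `A` as a continuous linear map on `E →L F`. [folklore] -/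
def precompCLM (A : E →L[ℝ] E) : (E →L[ℝ] F) →L[ℝ] (E →L[ℝ] F) :=
  (ContinuousLinearMap.compL ℝ E E F).flip A

omit [FiniteDimensional ℝ E] in
/-- `precompCLM_apply`: `precompCLM A P = P ∘ A`. [folklore] -/
theorem precompCLM_apply (A : E →L[ℝ] E) (P : E →L[ℝ] F) : precompCLM A P = P.comp A := by
  simp [precompCLM]

/-- **The full operator under an affine change of variables** `φ y = A y + c`:
`frameOp S 𝔟 𝔠 (v' ∘ φ) y = frameOp (A S A†) (𝔟 ∘ precomp A) 𝔠 v' (φ y)`.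
[cite: Hormander1985III, §17.1] -/
theorem frameOp_comp_affine (A : E ≃L[ℝ] E) (c : E) (S : E →L[ℝ] E) (𝔟 : (E →L[ℝ] F) →L[ℝ] F)
    (𝔠 : F →L[ℝ] F) {v' : E → F} (hv' : ContDiff ℝ 2 v') (y : E) :
    frameOp S 𝔟 𝔠 (fun y ↦ v' (A y + c)) y =
      frameOp ((A : E →L[ℝ] E) ∘L S ∘L ContinuousLinearMap.adjoint (A : E →L[ℝ] E))
        (𝔟 ∘L precompCLM (A : E →L[ℝ] E)) 𝔠 v' (A y + c) := by
  rw [frameOp_apply, frameOp_apply, principalPart_comp_affine S hv' y, fderiv_comp_affine,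
    ContinuousLinearMap.comp_apply, precompCLM_apply]

end Operator

end Literature.Analysis.PDE

end
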